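import Summits.ResolutionOfSingularities.ResolutionOfSingularities.Theorems.HilbertSamuelEliminationSigmaMaxModificationsCorridor3SigmaBoundaryBPermissible
import Literature.AlgebraicGeometry.Resolution.BlowupStalkBlowupAlgebra
import Literature.AlgebraicGeometry.Resolution.BlowupChartModule
import Literature.AlgebraicGeometry.Resolution.BlowupOffCentre
import Literature.AlgebraicGeometry.Resolution.BlowupDisjointCentreSplitting
import Literature.AlgebraicGeometry.Resolution.BlowupSNC
import Literature.AlgebraicGeometry.Resolution.NonPrincipalLocus
import Literature.AlgebraicGeometry.Resolution.KollarEtaleNeighbourhood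
import Literature.AlgebraicGeometry.Resolution.IdealSheafLocalGenerator
import Literature.AlgebraicGeometry.Resolution.StalkIdealLemmas
import Literature.AlgebraicGeometry.Resolution.SncSaturatedCentre
import Literature.AlgebraicGeometry.Resolution.MarkedIdealsLemmas
import Literature.AlgebraicGeometry.Resolution.MarkedIdealsEtale
import Literature.AlgebraicGeometry.Resolution.PermissibleCentres
import Literature.RingTheory.HilbertSamuel.NormalFlatness
import Mathlib.RingTheory.Flat.TorsionFree
import HarnessLib

/-!
# [OURS · L1 W4.2] σ-LAYER (D1′) — THE OFF-MEMBER COINCIDENCE LAW, PROVED: for a permissible centre `C` with irreducible support and a locally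
# principal member `B` not containing it, the scheme-theoretic strict transform of `B` is its total transform, `B̃ = π^* B`
# (cell res-hironaka, LADDER-RESOLUTION rung L; slot W4.2, crux chain w42 `SigmaMaxModificationsCorridor3` stmt-ResolutionOfSingularities-19249;
# `--supports stmt-ResolutionOfSingularities-19249 --as helper`; res-L1-w42-plan-1 RULING v3.14-44 (KP) «060 g8 NEW OBJECT := (D1′)», statement
# VERBATIM res-L1-type-o1's `Sigma.OffMemberCoincidenceLaw` (`…Corridor3SigmaBoundaryBPermissible`, p552583); hand res-D-pv-060 (gen 8))

OURS bookkeeping, 0 `def`s, every declaration PROVED; NOT a statement of Hironaka's manuscript [Hironaka2017] nor of [CossartJannsenSaito2020]. AI-written,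
weaker than expert review.

THE STATEMENT (o1, verbatim): `OffMemberCoincidenceLaw W := ∀ C B, IdealSheafData.IsPermissible C → IsIrreducible C.support → IsLocallyPrincipal B →
¬ B ≤ C → Boundary.MemberCoincides C B`, which off the member unfolds (`Boundary.memberCoincides_iff_of_not_le`) to
`strictTransformIdeal (blowup.π C) C B = B.comap (blowup.π C)`.

ROUTE (o1's sketch, ANSWER (KP) 17:10:01Z, carried out):
* `Ideal.IsNormallyFlat.mem_pow_of_mul_mem_pow` — normal flatness along the prime `𝔭` (CJS Def. 3.1 (1): `𝔭ⁿ/𝔭ⁿ⁺¹` flat, hence torsion-free,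
  over the domain `A/𝔭`) makes every `f ∉ 𝔭` a non-zero-divisor modulo every `𝔭ⁿ`: `(𝔭ⁿ : f) = 𝔭ⁿ`.
* `blowupAlgebra.exists_eq_mul_of_mul_pow_eq` — THE CHART COMPUTATION on `A[𝔭/g]`: if `u·g^n ∈ f·A[𝔭/g]` then `u ∈ f·A[𝔭/g]` (write `u = a/gᵏ`,
  clear denominators in `A[1/g]`, apply `(𝔭ᵐ : f) = 𝔭ᵐ`); `blowupAlgebra.colon_span_eq` — `(f·A[𝔭/g] : gⁿ) = f·A[𝔭/g]`.
* `stalkIdeal_not_le_of_not_le` — the side conditions at a point: `C` permissible (stalks prime with regular quotient, so RADICAL), `V(C)`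
  IRREDUCIBLE, `B` locally principal, `¬ B ≤ C` ⇒ at every `x ∈ V(C)` the local generator `f` of `B` is NOT in `𝔭 = 𝓘_{C,x}` (a germ inclusion
  spreads to a basic open neighbourhood — tree `exists_basicOpen_forall_germ_mem_stalkIdeal` —, whose trace on the irreducible `V(C)` is dense,
  so `V(C) ⊆ V(B)` and `B ≤ √C = C` stalkwise).
* **`offMemberCoincidenceLaw_holds`** — assembly at each point `x'` of the blow-up: off `V(C)` by `IsBlowup.stalkIdeal_strictTransformIdeal_of_not_mem`;
  over `x ∈ V(C)` the stalk `𝒪_{x'}` is a localisation of `𝒪_{W,x}[𝔭/c_j]` (tree `IsBlowup.exists_blowupAlgebra_stalk_ringEquiv`) with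
  `𝓘_{E,x'} = (c_j)` (`stalkIdeal_controlledTransform_eq_map_of_isLocalization`), and the colon identity passes to the flat localisation
  (`Ideal.map_colon_of_flat`).

References: CJS LNM 2270 Def. 3.1, Def. 5.5, (5.2)–(5.6) [CossartJannsenSaito2020]; Görtz–Wedhorn I (13.19) [GortzWedhorn2020]; Stacks 0804, 07Z3
[StacksProject].
-/

noncomputable section

set_option linter.dupNamespace false

open CategoryTheory AlgebraicGeometry TopologicalSpace IsLocalRing
open Summit.ResolutionOfSingularities.ResolutionOfSingularities.Theorems.CampaignW42
open Literature.AlgebraicGeometry.Resolution Literature.RingTheory.HilbertSamuel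

universe u

/-! ## §1. Normal flatness: `f ∉ 𝔭` is a non-zero-divisor modulo every `𝔭ⁿ` -/

/-- **`(𝔭ⁿ : f) = 𝔭ⁿ` along a normally flat prime.** If `𝔭` is a prime of `A` along which `A` is normally flat (every `𝔭ⁱ/𝔭ⁱ⁺¹` flat over the
domain `A/𝔭`, hence torsion-free) and `f ∉ 𝔭`, then `f·c ∈ 𝔭ⁿ ⇒ c ∈ 𝔭ⁿ`. [cite: CossartJannsenSaito2020, Def. 3.1 (1), (5.6)] -/
theorem Ideal.IsNormallyFlat.mem_pow_of_mul_mem_pow {A : Type u} [CommRing A] {p : Ideal A} [p.IsPrime] (hNF : p.IsNormallyFlat)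
    {f : A} (hf : f ∉ p) (n : ℕ) {c : A} (h : f * c ∈ p ^ n) : c ∈ p ^ n := by
  have hx0 : Ideal.Quotient.mk p f ≠ 0 := fun h0 => hf (Ideal.Quotient.eq_zero_iff_mem.mp h0)
  have hxreg : Ideal.Quotient.mk p f ∈ nonZeroDivisors (A ⧸ p) := mem_nonZeroDivisors_of_ne_zero hx0
  have key : ∀ i ≤ n, c ∈ p ^ i := by
    intro i
    induction i with
    | zero => intro; simp
    | succ i ih =>
      intro hi
      have hci : c ∈ p ^ i := ih (Nat.le_of_succ_le hi)
      haveI : Module.Flat (A ⧸ p) (gradedPiece p i) := hNF i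
      have hsm : IsSMulRegular (gradedPiece p i) (Ideal.Quotient.mk p f) := Module.Flat.isSMulRegular_of_nonZeroDivisors hxreg
      have h0 : (Ideal.Quotient.mk p f) • gradedPiece.mk p i ⟨c, hci⟩ = 0 := by
        change f • gradedPiece.mk p i ⟨c, hci⟩ = 0
        rw [← map_smul, gradedPiece.mk_eq_zero_iff]
        exact Ideal.pow_le_pow_right hi h
      have h1 : gradedPiece.mk p i ⟨c, hci⟩ = 0 :=
        hsm (show (Ideal.Quotient.mk p f) • gradedPiece.mk p i ⟨c, hci⟩ = (Ideal.Quotient.mk p f) • (0 : gradedPiece p i) by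
          rw [h0, smul_zero])
      rw [gradedPiece.mk_eq_zero_iff] at h1
      exact h1
  exact key n le_rfl

/-! ## §2. The chart computation on `A[𝔭/g]` -/

namespace Literature.AlgebraicGeometry.Resolution

section Chart

variable {A : Type u} [CommRing A] {𝔭 : Ideal A} {g f : A}

/-- **`g` is a non-zero-divisor modulo `f` on the chart `A[𝔭/g]`** when `(𝔭ⁿ : f) = 𝔭ⁿ` for all `n`: if `u · gⁿ ∈ f · A[𝔭/g]` then `u ∈ f · A[𝔭/g]`.
(`u = a/gᵏ`, `a ∈ 𝔭ᵏ`; `u gⁿ = f · b/gˡ`, `b ∈ 𝔭ˡ`; in `A`: `a g^{n+l+N} = f b g^{k+N}` for some `N`, so `b g^{k+N} ∈ (𝔭^{k+n+l+N} : f) = 𝔭^{k+n+l+N}` and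
`u = f · (b g^{k+N}) / g^{k+n+l+N}`.) [cite: CossartJannsenSaito2020, (5.6)] [cite: StacksProject, Tag 07Z3] -/
theorem blowupAlgebra.exists_eq_mul_of_mul_pow_eq (hg : g ∈ 𝔭) (hsat : ∀ (n : ℕ) {c : A}, f * c ∈ 𝔭 ^ n → c ∈ 𝔭 ^ n)
    (u w : blowupAlgebra 𝔭 g) (n : ℕ)
    (h : u * algebraMap A (blowupAlgebra 𝔭 g) g ^ n = algebraMap A (blowupAlgebra 𝔭 g) f * w) :
    ∃ w' : blowupAlgebra 𝔭 g, u = algebraMap A (blowupAlgebra 𝔭 g) f * w' := by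
  obtain ⟨k, a, ha, hu⟩ := blowupAlgebra.exists_eq_mul_invSelf_pow 𝔭 g hg u.2
  obtain ⟨l, b, hb, hw⟩ := blowupAlgebra.exists_eq_mul_invSelf_pow 𝔭 g hg w.2
  have hgi : ∀ m : ℕ, algebraMap A (Localization.Away g) g ^ m * IsLocalization.Away.invSelf g ^ m = 1 := fun m => by
    have := algebraMap_pow_mul_invSelf_pow g m
    rwa [map_pow] at this
  -- the equation in `A[1/g]`, denominators cleared
  have h' : (u : Localization.Away g) * algebraMap A (Localization.Away g) g ^ n =
      algebraMap A (Localization.Away g) f * (w : Localization.Away g) := by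
    have := congrArg Subtype.val h
    simpa using this
  rw [hu, hw] at h'
  have h2 : algebraMap A (Localization.Away g) a * algebraMap A (Localization.Away g) g ^ n * algebraMap A (Localization.Away g) g ^ l =
      algebraMap A (Localization.Away g) f * algebraMap A (Localization.Away g) b * algebraMap A (Localization.Away g) g ^ k := by
    have hk := hgi k
    have hl := hgi l
    linear_combination (algebraMap A (Localization.Away g) g ^ k * algebraMap A (Localization.Away g) g ^ l) * h' -
      (algebraMap A (Localization.Away g) a * algebraMap A (Localization.Away g) g ^ n * algebraMap A (Localization.Away g) g ^ l) * hk +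
      (algebraMap A (Localization.Away g) f * algebraMap A (Localization.Away g) b * algebraMap A (Localization.Away g) g ^ k) * hl
  have heq : algebraMap A (Localization.Away g) (a * g ^ (n + l)) = algebraMap A (Localization.Away g) (f * b * g ^ k) := by
    simp only [map_mul, map_pow, pow_add]
    linear_combination h2
  obtain ⟨c, hc⟩ := (IsLocalization.eq_iff_exists (Submonoid.powers g) (Localization.Away g)).mp heq
  obtain ⟨N, hN⟩ := (Submonoid.mem_powers_iff _ _).mp c.2
  have hcA : a * g ^ (n + l + N) = f * (b * g ^ (k + N)) := by
    have hc' : g ^ N * (a * g ^ (n + l)) = g ^ N * (f * b * g ^ k) := by rw [hN]; exact hc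
    calc a * g ^ (n + l + N) = g ^ N * (a * g ^ (n + l)) := by ring
      _ = g ^ N * (f * b * g ^ k) := hc'
      _ = f * (b * g ^ (k + N)) := by ring
  -- `f · (b g^{k+N}) = a g^{n+l+N} ∈ 𝔭^{k+n+l+N}`
  have hmem : f * (b * g ^ (k + N)) ∈ 𝔭 ^ (k + (n + l + N)) := by
    rw [← hcA, pow_add]
    exact Ideal.mul_mem_mul ha (Ideal.pow_mem_pow hg _)
  have hb' : b * g ^ (k + N) ∈ 𝔭 ^ (k + (n + l + N)) := hsat _ hmem
  refine ⟨blowupAlgebra.divPow 𝔭 g hb', Subtype.ext ?_⟩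
  rw [Subalgebra.coe_mul, Subalgebra.coe_algebraMap, blowupAlgebra.coe_divPow, hu]
  -- `a/gᵏ = f · (b g^{k+N}) / g^{k+n+l+N}`
  calc algebraMap A (Localization.Away g) a * IsLocalization.Away.invSelf g ^ k
      = algebraMap A (Localization.Away g) a * IsLocalization.Away.invSelf g ^ k *
          (algebraMap A (Localization.Away g) g ^ (n + l + N) * IsLocalization.Away.invSelf g ^ (n + l + N)) := by
        rw [hgi, mul_one]
    _ = algebraMap A (Localization.Away g) (a * g ^ (n + l + N)) * IsLocalization.Away.invSelf g ^ (k + (n + l + N)) := by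
        rw [map_mul, map_pow, pow_add]; ring
    _ = algebraMap A (Localization.Away g) (f * (b * g ^ (k + N))) * IsLocalization.Away.invSelf g ^ (k + (n + l + N)) := by
        rw [hcA]
    _ = algebraMap A (Localization.Away g) f *
          (algebraMap A (Localization.Away g) (b * g ^ (k + N)) * IsLocalization.Away.invSelf g ^ (k + (n + l + N))) := by
        rw [map_mul]; ring

/-- **`(f · A[𝔭/g] : gⁿ) = f · A[𝔭/g]`** under `(𝔭ᵐ : f) = 𝔭ᵐ` for all `m`. [cite: CossartJannsenSaito2020, (5.6)] -/
theorem blowupAlgebra.colon_span_eq (hg : g ∈ 𝔭) (hsat : ∀ (n : ℕ) {c : A}, f * c ∈ 𝔭 ^ n → c ∈ 𝔭 ^ n) (n : ℕ) :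
    (Ideal.span {algebraMap A (blowupAlgebra 𝔭 g) f}).colon
        ((Ideal.span {algebraMap A (blowupAlgebra 𝔭 g) g ^ n} : Ideal (blowupAlgebra 𝔭 g)) : Set (blowupAlgebra 𝔭 g)) =
      Ideal.span {algebraMap A (blowupAlgebra 𝔭 g) f} := by
  refine le_antisymm (fun u hu => ?_) (fun u hu => Submodule.mem_colon.mpr fun p _ => ?_)
  swap
  · rw [smul_eq_mul]; exact Ideal.mul_mem_right p _ hu
  rw [Submodule.mem_colon] at hu
  have h1 : u * algebraMap A (blowupAlgebra 𝔭 g) g ^ n ∈ Ideal.span {algebraMap A (blowupAlgebra 𝔭 g) f} := by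
    have := hu (algebraMap A (blowupAlgebra 𝔭 g) g ^ n) (Ideal.mem_span_singleton_self _)
    rwa [smul_eq_mul] at this
  obtain ⟨w, hw⟩ := Ideal.mem_span_singleton'.mp h1
  obtain ⟨w', hw'⟩ := blowupAlgebra.exists_eq_mul_of_mul_pow_eq hg hsat u w n (by rw [← hw, mul_comm])
  exact Ideal.mem_span_singleton'.mpr ⟨w', by rw [hw', mul_comm]⟩

end Chart

/-! ## §3. The side conditions at a point of the centre -/

section Point

variable {W : Scheme.{u}} [IsLocallyNoetherian W] {C B : W.IdealSheafData}

omit [IsLocallyNoetherian W] in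
/-- **Off-member, pointwise.** For a permissible centre `C` with irreducible support, a locally principal `B` and `¬ B ≤ C`: at every point `x`
of `V(C)` the stalk of `B` is NOT contained in the (prime) stalk of `C`. [cite: CossartJannsenSaito2020, Def. 3.1, (5.6)] -/
theorem stalkIdeal_not_le_of_not_le (hperm : IdealSheafData.IsPermissible C) (hirr : IsIrreducible (C.support : Set W))
    (hlp : IsLocallyPrincipal B) (hBC : ¬ B ≤ C) {x : W} (hx : x ∈ C.support) : ¬ stalkIdeal B x ≤ stalkIdeal C x := by
  intro hle
  apply hBC
  -- a local generator `f` of `B` near `x`, with germ in `C_x`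
  obtain ⟨U, hxU, f, hf⟩ := hlp x
  have hBx : stalkIdeal B x = Ideal.span {(W.presheaf.germ U x hxU).hom f} :=
    stalkIdeal_eq_span_germ_of_ideal_eq_span B (W := U) le_rfl f (by simpa using hf) hxU
  have hfx : (W.presheaf.germ U x hxU).hom f ∈ stalkIdeal C x := hle (hBx ▸ Ideal.mem_span_singleton_self _)
  -- spread the germ inclusion to a basic open neighbourhood
  obtain ⟨t, hxt, ht⟩ := exists_basicOpen_forall_germ_mem_stalkIdeal C U hxU f hfx
  -- on `D(t)`: `V(C) ∩ D(t) ⊆ V(B)`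
  have hsub : (C.support : Set W) ∩ (W.basicOpen t : Set W) ⊆ (B.support : Set W) := by
    rintro y ⟨hyC, hyt⟩
    have hBy : stalkIdeal B y = Ideal.span {(W.presheaf.germ U y (W.basicOpen_le t hyt)).hom f} :=
      stalkIdeal_eq_span_germ_of_ideal_eq_span B (W := U) le_rfl f (by simpa using hf) (W.basicOpen_le t hyt)
    have hyC' : y ∈ C.support := hyC
    show y ∈ B.support
    rw [mem_support_iff_stalkIdeal_ne_top] at hyC' ⊢
    intro htop
    apply hyC'
    rw [eq_top_iff, ← htop, hBy, Ideal.span_singleton_le_iff_mem]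
    exact ht y hyt
  -- irreducibility: `V(C) ⊆ V(B)`
  have hsupp : (C.support : Set W) ⊆ B.support := by
    intro y hyC
    by_contra hyB
    obtain ⟨z, hzC, hzt, hzB⟩ := hirr.isPreirreducible _ _ (W.basicOpen t).isOpen B.support.isClosed.isOpen_compl
      ⟨x, hx, hxt⟩ ⟨y, hyC, hyB⟩
    exact hzB (hsub ⟨hzC, hzt⟩)
  -- `B ≤ √C = C` stalkwise
  have hrad : B ≤ C.radical := by
    rw [← Scheme.IdealSheafData.vanishingIdeal_support]
    exact Scheme.IdealSheafData.le_support_iff_le_vanishingIdeal.mp hsupp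
  refine le_of_forall_stalkIdeal_le fun y => ?_
  by_cases hyC : y ∈ C.support
  · have hprime : (stalkIdeal C y).IsPrime := by
      haveI := (hperm y hyC).isRegularLocalRing
      haveI : IsDomain ((W.presheaf.stalk y : Type u) ⧸ stalkIdeal C y) := isDomain_of_isRegularLocalRing _
      exact (Ideal.Quotient.isDomain_iff_prime _).mp inferInstance
    calc stalkIdeal B y ≤ stalkIdeal C.radical y := stalkIdeal_mono hrad y
      _ = (stalkIdeal C y).radical := stalkIdeal_radical C y
      _ = stalkIdeal C y := hprime.radical
  · have : stalkIdeal C y = ⊤ := by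
      by_contra hne; exact hyC ((mem_support_iff_stalkIdeal_ne_top C y).mpr hne)
    rw [this]; exact le_top

end Point

end Literature.AlgebraicGeometry.Resolution

/-! ## §4. The law -/

namespace Summit.ResolutionOfSingularities.ResolutionOfSingularities.Theorems.SigmaMaxModificationsCorridor3.Sigma

set_option maxHeartbeats 400000 in
/-- [OURS · L1 W4.2] **(D1′) THE OFF-MEMBER COINCIDENCE LAW HOLDS on every locally Noetherian scheme**: for a PERMISSIBLE centre `C` (CJS Def. 3.1:
regular, `W` normally flat along it) with IRREDUCIBLE support and a LOCALLY PRINCIPAL `B` with `¬ B ≤ C`, the scheme-theoretic strict transform of `B`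
under the blow-up of `C` is the total transform, `B̃ = π^* B` — so the run's member transform coincides with CJS's principal strict transform
(`Boundary.MemberCoincides`). See the module docstring for the route (res-L1-type-o1's). [cite: CossartJannsenSaito2020, Def. 3.1, Def. 5.5, (5.6)]
[cite: GortzWedhorn2020, (13.19)] -/
theorem offMemberCoincidenceLaw_holds (W : Scheme.{u}) [IsLocallyNoetherian W] : OffMemberCoincidenceLaw W := by
  intro C B hperm hirr hlp hBC
  rw [Boundary.memberCoincides_iff_of_not_le hBC]
  have hπ := blowup.isBlowup C
  haveI : IsLocallyNoetherian (blowup C) := hπ.isLocallyNoetherian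
  refine le_antisymm (le_of_forall_stalkIdeal_le fun x' => ?_) ?_
  swap
  · have h0 := controlledTransform_le_strictTransformIdeal (blowup.π C) C B 0
    rwa [controlledTransform_zero] at h0
  by_cases hx : (blowup.π C) x' ∈ C.support
  swap
  · rw [hπ.stalkIdeal_strictTransformIdeal_of_not_mem B hx]
  -- over a point `x = π x'` of the centre: `𝔭 = 𝓘_{C,x}` is a permissible prime
  have hpermx : (stalkIdeal C ((blowup.π C) x')).IsPermissible := hperm _ hx
  haveI := hpermx.isRegularLocalRing
  haveI h𝔭p : (stalkIdeal C ((blowup.π C) x')).IsPrime := by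
    haveI : IsDomain ((W.presheaf.stalk ((blowup.π C) x') : Type u) ⧸ stalkIdeal C ((blowup.π C) x')) :=
      isDomain_of_isRegularLocalRing _
    exact (Ideal.Quotient.isDomain_iff_prime _).mp inferInstance
  -- the local generator `f` of `B` at `x`, not in `𝔭`
  obtain ⟨f, hf⟩ := (hlp ((blowup.π C) x')).isPrincipal_stalkIdeal
  have hBx : stalkIdeal B ((blowup.π C) x') = Ideal.span {f} := hf
  have hfp : f ∉ stalkIdeal C ((blowup.π C) x') := fun hmem =>
    stalkIdeal_not_le_of_not_le hperm hirr hlp hBC hx (by rw [hBx, Ideal.span_singleton_le_iff_mem]; exact hmem)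
  -- generators of `𝔭` and the chart presentation of `𝒪_{x'}`
  obtain ⟨k, c, hc⟩ := (Submodule.fg_iff_exists_fin_generating_family).mp (IsNoetherian.noetherian (stalkIdeal C ((blowup.π C) x')))
  have hc' : Ideal.span (Set.range c) = stalkIdeal C ((blowup.π C) x') := hc
  have hsat : ∀ (n : ℕ) {y : (W.presheaf.stalk ((blowup.π C) x') : Type u)},
      f * y ∈ Ideal.span (Set.range c) ^ n → y ∈ Ideal.span (Set.range c) ^ n := by
    intro n y h
    rw [hc'] at h ⊢
    exact hpermx.isNormallyFlat.mem_pow_of_mul_mem_pow hfp n h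
  obtain ⟨j, 𝔔, χ, e, hχ, hloc, -, -⟩ := hπ.exists_blowupAlgebra_stalk_ringEquiv x' c hc'
  obtain ⟨hE, -⟩ := hπ.stalkIdeal_controlledTransform_eq_map_of_isLocalization x' c hc' j 𝔔 χ hχ hloc
  have hcj : c j ∈ Ideal.span (Set.range c) := Ideal.subset_span ⟨j, rfl⟩
  -- the colon identity on the chart, transported to the stalk along the flat localisation `χ`
  letI := χ.toAlgebra
  haveI : IsLocalization.AtPrime ((blowup C).presheaf.stalk x' : Type u) 𝔔.asIdeal := hloc
  haveI : Module.Flat (blowupAlgebra (Ideal.span (Set.range c)) (c j)) ((blowup C).presheaf.stalk x' : Type u) :=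
    IsLocalization.flat _ 𝔔.asIdeal.primeCompl
  rw [stalkIdeal_strictTransformIdeal (blowup.π C) C B x', hE, stalkIdeal_comap_eq_map_stalkMap, hBx, Ideal.map_span,
    Set.image_singleton]
  refine iSup_le fun n => ?_
  have hcol := blowupAlgebra.colon_span_eq (𝔭 := Ideal.span (Set.range c)) (g := c j) (f := f) hcj hsat n
  have hmap := Ideal.map_colon_of_flat (A := blowupAlgebra (Ideal.span (Set.range c)) (c j)) (B := ((blowup C).presheaf.stalk x' : Type u))
    (Ideal.span {algebraMap _ (blowupAlgebra (Ideal.span (Set.range c)) (c j)) f})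
    (Ideal.span {algebraMap _ (blowupAlgebra (Ideal.span (Set.range c)) (c j)) (c j) ^ n}) (Submodule.fg_span_singleton _)
  rw [hcol] at hmap
  rw [RingHom.algebraMap_toAlgebra, Ideal.map_span, Set.image_singleton, Ideal.map_span, Set.image_singleton, map_pow, hχ, hχ] at hmap
  rw [Ideal.span_singleton_pow]
  exact le_of_eq hmap.symm

end Summit.ResolutionOfSingularities.ResolutionOfSingularities.Theorems.SigmaMaxModificationsCorridor3.Sigma

end
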